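import Literature.NumberTheory.Rogawski1990.ArchCartanWallExtensionG      -- (G′-EXT) piece (1) (LH3-p02 (g2)): `hcExtendG` + transport of (P)(W)(I₄), `archRG_eq_zero_of_not_mem_regG`
import Literature.NumberTheory.Rogawski1990.ArchTransfFamilyBouaziz       -- ★ p850089 (LH3-p02 (g2)): the assembler (+ ★ `ArchHCOrbitalFamilyGClauses`: (P)(W)(I₄) of the RAW `orbFamG`, ED. 4 iff; ★ `ArchTransfFamily`: `transfFam`, `bzExtendG`)
import HarnessLib

/-!
# `orbFamGExt ν′ a′` — the WALL-EXTENDED genuine `G′`-family (repair R1′ of the (J-CENSUS) §0 finding): the raw `R′`-normalised orbital family ★ `orbFamG` extended from the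
# `G`-regular set across the compact and real walls; its clauses (P), (W), (I₄); `transfFam` does not see the difference (Harish-Chandra ∕ Varadarajan 1977 I §1.12; Bouaziz 1994 §3.1)

Topic `NumberTheory/Rogawski1990`; namespace `Literature.NumberTheory.Rogawski1990`.  ONE definition WITH BODY + theorems (no instance, no notation, no axiom, no named fact,
no `sorry`).  Cell `pub/hodgecm-mathlib`, crux H413 (`stmt-HodgeConjecture-24833`), F0∕P3c line LH3 (closer stub `stub_N9`, DIRECT ROAD `F0_P3c_StubN9Direct`): brick **(G′-EXT)**,
pieces (2)–(4) (LH3-plan (g3) RULING #3, 2026-09-02T07:23:12Z, on the (J-CENSUS) of LH4-p03 (g4)); LH3-p02 (g2), owner of ★ `orbFamG`.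

THE DEFECT AND THE REPAIR.  ★ `orbFamG ν′ a′ S′ c = archRG S′ c · chartOrbG ν′ S′ a′ c` (admissible `S′`) is Shelstad's RAW `Ψ^T_f = R_T · Φ_f` read at the chart point: on the
real wall `x_w = 0` of a split place `w ∈ S′` the normaliser ★ `archRG S′` carries `|e^{x_w} − e^{−x_w}| = 0` (and the chart point is semiregular, the quotient integral junk), so
the raw family VANISHES IDENTICALLY there — whereas Harish-Chandra's `'F_f` EXTENDS CONTINUOUSLY (with all derivatives, `C^∞` across) to the real walls with a NON-ZERO value
(the Abel-type ∕ Rao cone integral) [Varadarajan1977, I §1.12].  The letter L1 of the direct road (`orbFamG ν′ a′ ∈ ArchHCSpaceG (slotSign L α) jc′`) reads exactly these wall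
values: (I₁) asks `ContDiffOn` on ★ `InRegG` (real walls kept) and (I₃)'s right side reads the Cayley point ★ `hcCayPt` (`x_w := 0`).  So L1 is print-true for the EXTENDED family
only.  REPAIR R1′ (tree-safe: ★ `orbFamG` and everything proved about it stay byte-identical — the R1 junction ★ `classOrbitalIntegral_mul_measure_box_eq_chartOrbG` and O-READ
live on `RegG`, where the two families agree literally):
**`orbFamGExt L α ν′ a′ := fun S′ => hcExtendG (slotSign L α) S′ (orbFamG L α ν′ a′ S′)`** — literally `orbFamG` on ★ `RegG S′`, its `RegG`-limit on the compact and real walls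
(`InRegG (slotSign L α) S′ ∖ RegG S′`, where it exists — Harish-Chandra; the letter's content, not assumed), `0` on the noncompact imaginary walls; `0` on the junk labels.

* §1 `orbFamGExt` + `orbFamGExt_apply`, `orbFamGExt_of_mem_regG` (= the raw value), `orbFamGExt_eqOn_regG`, `orbFamGExt_of_not_admissible` (= `0`), `orbFamGExt_zero`,
  **`orbFamGExt_eq_of_tendsto`** (the dock: a `RegG`-limit of `archRG · chartOrbG` at a wall point IS the value — where (J-DESC)∕(A0-b)-type computations of Cayley values land).
* §2 THE CLAUSES for the extended genuine family, HC-free: **`archHcPeriodic_orbFamGExt (a′)`**, **`archHcWeyl_orbFamGExt (hα) (hreal) (a′)`**, **`archHcCompactSupport_orbFamGExt (hc′)`**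
  (★ raw clauses + piece (1)'s transports), and the L1 residue **`archHCSpaceG_orbFamGExt_iff (hα) (hreal) (hc′) (jc′) : ArchHCSpaceG (slotSign L α) jc′ (orbFamGExt L α ν′ a′) ↔
  ArchHcSmoothOneSided … ∧ ArchHcJump … jc′ …`** ∕ `archHCSpaceG_orbFamGExt`.
* §3 **`transfFam_orbFamGExt_eq : transfFam L α μ (orbFamGExt L α ν′ a′) = transfFam L α μ (orbFamG L α ν′ a′)`** — ★ `transfFam S = bzExtendG S (transfFamReg S)` reads the
  `G′`-family only at the partner points of `RegG S`, which are `G`-regular (★ `transfFamReg_congr`), and `bzExtendG S` reads its argument on `RegG S` only (`bzExtendG_congr`): organ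
  O-READ and R0 are INDIFFERENT to the repair.  §4 `archBouazizSpaceH_transfFam_orbFamGExt_iff` ∕ `_orbFamGExt` (the ★ assembler for the extended family).
HONEST LABEL: HC_CM is proved only modulo the 7 printed citations (2 remaining: hLiu418 = `stmt-HodgeConjecture-24832`, h413 = `stmt-HodgeConjecture-24833`) until rung 0 closes;
count-neutral (it repairs the currency of letter L1 ∕ organ J — one token `orbFamG ↦ orbFamGExt` in the HOME skeleton; nothing printed is paid here).

## References
* [Varadarajan1977] V. S. Varadarajan, *Harmonic Analysis on Real Reductive Groups*, LNM 576 (1977), Part I §1.12.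
* [Shelstad1979] D. Shelstad, *Characters and inner forms of a quasi-split group over ℝ*, Compositio Math. 39 (1979), §4 pp. 22–24 (`Ψ^T_f`, `Φ^{T,1}_f`).
* [Bouaziz1994IntegralesOrbitales] A. Bouaziz, *Intégrales orbitales sur les groupes de Lie réductifs*, Ann. Sci. ÉNS 27 (1994), §3.1–3.2 pp. 579–580, §6.2 p. 591, Rem. 2 p. 594.
* [Rogawski1990] J. D. Rogawski, *Automorphic Representations of Unitary Groups in Three Variables*, Ann. of Math. Stud. 123 (1990), §4.3 (4.3.1) p. 43, §4.9 Prop. 4.9.1 (a) p. 55.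
-/

set_option autoImplicit false

noncomputable section

open MeasureTheory MeasureTheory.Measure NumberField NumberField.InfinitePlace Matrix Complex Set Filter Topology
open scoped MatrixGroups Matrix Classical
open Literature.NumberTheory.Automorphic Literature.NumberTheory.Automorphic.UnitaryGroup Literature.NumberTheory.Automorphic.ArchCartan
open Literature.NumberTheory.GaloisRepresentations

namespace Literature.NumberTheory.Rogawski1990

/-! ## §1 The extended genuine family -/

section Ext

variable (L : Type) [Field L] [NumberField L] [IsCMField L] (α : Fin 3 → L)
  [MeasurableSpace ↥(arch (↥(maximalRealSubfield L)) L (IsCMField.complexConj L) 3 (Matrix.diagonal α))] [BorelSpace ↥(arch (↥(maximalRealSubfield L)) L (IsCMField.complexConj L) 3 (Matrix.diagonal α))]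
  (ν' : Measure ↥(arch (↥(maximalRealSubfield L)) L (IsCMField.complexConj L) 3 (Matrix.diagonal α))) [IsFiniteMeasureOnCompacts ν'] [ν'.IsMulRightInvariant]

/-- **`orbFamGExt ν′ a′` — THE WALL-EXTENDED `R′`-NORMALISED ORDINARY ORBITAL FAMILY OF `a′` ON THE `G′`-ATLAS**: on each chart label `S′` the ★ `hcExtendG` of the raw member
★ `orbFamG ν′ a′ S′` — literally `R′_{S′} · chartOrbG` on the `G`-regular set ★ `RegG S′`, Harish-Chandra's continuous extension (the `RegG`-limit, where it exists) on the compact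
and real walls of ★ `InRegG (slotSign L α) S′`, `0` on the noncompact imaginary walls; identically `0` on the junk labels (there the raw member is `0`).  Shelstad's `Φ^{T,1}_f`
[Shelstad1979, §4 p. 24], Harish-Chandra's `'F_f` on the closure of each chamber [Varadarajan1977, I §1.12]; the family the letter L1 speaks about.
[cite: Varadarajan1977, I §1.12] [cite: Shelstad1979, §4 p. 24] [cite: Bouaziz1994IntegralesOrbitales, §3.1 p. 579] -/
def orbFamGExt (a' : ↥(arch (↥(maximalRealSubfield L)) L (IsCMField.complexConj L) 3 (Matrix.diagonal α)) → ℂ) :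
    Finset {w : InfinitePlace L // IsComplex w} → ({w : InfinitePlace L // IsComplex w} → Fin 3 → ℝ) → ℂ :=
  fun S' => hcExtendG (slotSign L α) S' (orbFamG L α ν' a' S')

variable (a' : ↥(arch (↥(maximalRealSubfield L)) L (IsCMField.complexConj L) 3 (Matrix.diagonal α)) → ℂ) (S' : Finset {w : InfinitePlace L // IsComplex w})

/-- Unfolding of `orbFamGExt` on a chart. [cite: Shelstad1979, §4 p. 24] -/
theorem orbFamGExt_apply : orbFamGExt L α ν' a' S' = hcExtendG (slotSign L α) S' (orbFamG L α ν' a' S') := rfl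

/-- **On the `G`-regular set the extended family IS the raw one** (hence `= R′ · chartOrbG` on an admissible label, ★ `orbFamG_apply`). [cite: Shelstad1979, §4 p. 22] -/
theorem orbFamGExt_of_mem_regG {c : {w : InfinitePlace L // IsComplex w} → Fin 3 → ℝ} (hc : c ∈ RegG S') : orbFamGExt L α ν' a' S' c = orbFamG L α ν' a' S' c :=
  hcExtendG_of_mem_regG _ S' _ hc

/-- `orbFamGExt … S′` and `orbFamG … S′` agree on `RegG S′`. [cite: Shelstad1979, §4 p. 22] -/
theorem orbFamGExt_eqOn_regG : EqOn (orbFamGExt L α ν' a' S') (orbFamG L α ν' a' S') (RegG S') :=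
  hcExtendG_eqOn_regG _ S' _

/-- On an admissible label and a `G`-regular point: `orbFamGExt … S′ c = R′_{S′}(c) · chartOrbG ν′ S′ a′ c`. [cite: Shelstad1979, §4 p. 22] -/
theorem orbFamGExt_of_mem_regG_of_admissible (hS' : ∀ w, w ∈ S' → w ∈ splitChartPlaces L α) {c : {w : InfinitePlace L // IsComplex w} → Fin 3 → ℝ} (hc : c ∈ RegG S') :
    orbFamGExt L α ν' a' S' c = archRG S' c * chartOrbG L α ν' S' a' c := by
  rw [orbFamGExt_of_mem_regG L α ν' a' S' hc, orbFamG_apply L α ν' a' hS']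

/-- On a wall point of `InRegG (slotSign L α) S′` the value is the `RegG`-extension of the raw member. [cite: Varadarajan1977, I §1.12] -/
theorem orbFamGExt_of_mem_inRegG_of_not_mem_regG {c : {w : InfinitePlace L // IsComplex w} → Fin 3 → ℝ} (h1 : c ∈ InRegG (slotSign L α) S') (h2 : c ∉ RegG S') :
    orbFamGExt L α ν' a' S' c = extendFrom (RegG S') (orbFamG L α ν' a' S') c :=
  hcExtendG_of_mem_inRegG_of_not_mem_regG _ S' _ h1 h2

/-- Off `InRegG (slotSign L α) S′` (noncompact imaginary walls) the value is `0`. [cite: Bouaziz1994IntegralesOrbitales, §6.2 p. 591] -/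
theorem orbFamGExt_of_not_mem_inRegG {c : {w : InfinitePlace L // IsComplex w} → Fin 3 → ℝ} (h : c ∉ InRegG (slotSign L α) S') : orbFamGExt L α ν' a' S' c = 0 :=
  hcExtendG_of_not_mem_inRegG _ S' _ h

/-- **On a junk label the extended family is identically `0`** (the raw member is, ★ `orbFamG_of_not`; ★ `hcExtendG_zero`). [cite: Shelstad1979, §4 p. 22] -/
theorem orbFamGExt_of_not_admissible (hS' : ¬ ∀ w, w ∈ S' → w ∈ splitChartPlaces L α) : orbFamGExt L α ν' a' S' = fun _ => 0 := by
  rw [orbFamGExt_apply, orbFamG_of_not L α ν' a' hS', hcExtendG_zero]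

/-- **THE DOCK FOR CAYLEY VALUES**: at a wall point of `InRegG (slotSign L α) S′` off `RegG S′`, if the raw member `archRG S′ · chartOrbG ν′ S′ a′` (literally `orbFamG … S′` on an
admissible label) tends to `ℓ` along `RegG S′`, then `orbFamGExt … S′ c = ℓ` (★ `hcExtendG_eq_of_tendsto`). [cite: Varadarajan1977, I §1.12] [cite: Bouaziz1994IntegralesOrbitales, §3.1 (I₂) p. 579] -/
theorem orbFamGExt_eq_of_tendsto {c : {w : InfinitePlace L // IsComplex w} → Fin 3 → ℝ} (h1 : c ∈ InRegG (slotSign L α) S') (h2 : c ∉ RegG S') {ℓ : ℂ}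
    (h : Tendsto (orbFamG L α ν' a' S') (𝓝[RegG S'] c) (𝓝 ℓ)) : orbFamGExt L α ν' a' S' c = ℓ :=
  hcExtendG_eq_of_tendsto _ S' _ h1 h2 h

end Ext

section Zero

variable (L : Type) [Field L] [NumberField L] [IsCMField L] (α : Fin 3 → L)
  [MeasurableSpace ↥(arch (↥(maximalRealSubfield L)) L (IsCMField.complexConj L) 3 (Matrix.diagonal α))] [BorelSpace ↥(arch (↥(maximalRealSubfield L)) L (IsCMField.complexConj L) 3 (Matrix.diagonal α))]
  (ν' : Measure ↥(arch (↥(maximalRealSubfield L)) L (IsCMField.complexConj L) 3 (Matrix.diagonal α))) [IsFiniteMeasureOnCompacts ν'] [ν'.IsMulRightInvariant]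

/-- `orbFamGExt ν′ 0 = 0`. [cite: Shelstad1979, §4 p. 22] -/
theorem orbFamGExt_zero : orbFamGExt L α ν' (0 : ↥(arch (↥(maximalRealSubfield L)) L (IsCMField.complexConj L) 3 (Matrix.diagonal α)) → ℂ) = fun _ _ => 0 := by
  funext S'
  rw [orbFamGExt_apply, orbFamG_zero]
  exact hcExtendG_zero _ S'

end Zero

/-! ## §2 The clauses (P), (W), (I₄) for the extended genuine family; the residue of L1 -/

section Clauses

variable (L : Type) [Field L] [NumberField L] [IsCMField L] (α : Fin 3 → L)
  [MeasurableSpace ↥(arch (↥(maximalRealSubfield L)) L (IsCMField.complexConj L) 3 (Matrix.diagonal α))] [BorelSpace ↥(arch (↥(maximalRealSubfield L)) L (IsCMField.complexConj L) 3 (Matrix.diagonal α))]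
  (ν' : Measure ↥(arch (↥(maximalRealSubfield L)) L (IsCMField.complexConj L) 3 (Matrix.diagonal α))) [ν'.IsHaarMeasure] [ν'.IsMulRightInvariant]

/-- **(P) for the extended genuine family**, for every `a′` (★ `archHcPeriodic_orbFamG` transported). [cite: Shelstad1979, §4 p. 22] [cite: Bouaziz1994IntegralesOrbitales, §3.1 p. 579] -/
theorem archHcPeriodic_orbFamGExt (a' : ↥(arch (↥(maximalRealSubfield L)) L (IsCMField.complexConj L) 3 (Matrix.diagonal α)) → ℂ) : ArchHcPeriodic (orbFamGExt L α ν' a') :=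
  archHcPeriodic_hcExtendG (slotSign L α) _ (archHcPeriodic_orbFamG L α ν' a')

/-- **(W) for the extended genuine family** (★ `archHcWeyl_orbFamG` transported; compact half division-free and unconditional off `RegG`). [cite: Shelstad1979, §4 p. 23]
[cite: Bouaziz1994IntegralesOrbitales, §3.1 p. 579; §6.2 p. 591] -/
theorem archHcWeyl_orbFamGExt (hα : ∀ i, α i ≠ 0) (hreal : ∀ (w : {w : InfinitePlace L // IsComplex w}) (k : Fin 3), (w.1.embedding (α k)).im = 0)
    (a' : ↥(arch (↥(maximalRealSubfield L)) L (IsCMField.complexConj L) 3 (Matrix.diagonal α)) → ℂ) : ArchHcWeyl (slotSign L α) (orbFamGExt L α ν' a') :=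
  archHcWeyl_hcExtendG (slotSign L α) _ (archHcWeyl_orbFamG L α ν' hα hreal a')

/-- **(I₄) for the extended genuine family** of a compactly supported `a′` (★ `archHcCompactSupport_orbFamG` transported). [cite: Bouaziz1994IntegralesOrbitales, §3.1 (I₄) p. 579] -/
theorem archHcCompactSupport_orbFamGExt {a' : ↥(arch (↥(maximalRealSubfield L)) L (IsCMField.complexConj L) 3 (Matrix.diagonal α)) → ℂ} (hc' : HasCompactSupport a') :
    ArchHcCompactSupport (orbFamGExt L α ν' a') :=
  archHcCompactSupport_hcExtendG (slotSign L α) _ (archHcCompactSupport_orbFamG L α ν' hc')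

/-- **THE RESIDUE OF LETTER L1 FOR THE EXTENDED GENUINE FAMILY**: `orbFamGExt ν′ a′ ∈ ArchHCSpaceG (slotSign L α) jc′` iff its two Harish-Chandra clauses hold ((I₁)+one-sided structure,
(I₃)) — (P), (W), (I₄) are theorems.  This is the print-true form of L1 [Varadarajan1977, I §1.12; Bouaziz 1994 §3.2 «`J_G(φ) ∈ I(U)`»].
[cite: Bouaziz1994IntegralesOrbitales, §3.2 p. 580] [cite: Shelstad1979, Thm. 4.7 (p. 31)] [cite: Varadarajan1977, I §1.12] -/
theorem archHCSpaceG_orbFamGExt_iff (hα : ∀ i, α i ≠ 0) (hreal : ∀ (w : {w : InfinitePlace L // IsComplex w}) (k : Fin 3), (w.1.embedding (α k)).im = 0)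
    {a' : ↥(arch (↥(maximalRealSubfield L)) L (IsCMField.complexConj L) 3 (Matrix.diagonal α)) → ℂ} (hc' : HasCompactSupport a')
    (jc' : Finset {w : InfinitePlace L // IsComplex w} → {w : InfinitePlace L // IsComplex w} → Fin 3 → Fin 3 → ℂ) :
    ArchHCSpaceG (slotSign L α) jc' (orbFamGExt L α ν' a') ↔
      ArchHcSmoothOneSided (slotSign L α) (orbFamGExt L α ν' a') ∧ ArchHcJump (slotSign L α) jc' (orbFamGExt L α ν' a') :=
  ⟨fun h => ⟨h.2.2.1, h.2.2.2.2⟩,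
    fun h => ⟨archHcPeriodic_orbFamGExt L α ν' a', archHcWeyl_orbFamGExt L α ν' hα hreal a', h.1, archHcCompactSupport_orbFamGExt L α ν' hc', h.2⟩⟩

/-- From the two Harish-Chandra clauses to the full membership. [cite: Bouaziz1994IntegralesOrbitales, §3.2 p. 580] -/
theorem archHCSpaceG_orbFamGExt (hα : ∀ i, α i ≠ 0) (hreal : ∀ (w : {w : InfinitePlace L // IsComplex w}) (k : Fin 3), (w.1.embedding (α k)).im = 0)
    {a' : ↥(arch (↥(maximalRealSubfield L)) L (IsCMField.complexConj L) 3 (Matrix.diagonal α)) → ℂ} (hc' : HasCompactSupport a')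
    {jc' : Finset {w : InfinitePlace L // IsComplex w} → {w : InfinitePlace L // IsComplex w} → Fin 3 → Fin 3 → ℂ}
    (hI1 : ArchHcSmoothOneSided (slotSign L α) (orbFamGExt L α ν' a')) (hI3 : ArchHcJump (slotSign L α) jc' (orbFamGExt L α ν' a')) :
    ArchHCSpaceG (slotSign L α) jc' (orbFamGExt L α ν' a') :=
  (archHCSpaceG_orbFamGExt_iff L α ν' hα hreal hc' jc').2 ⟨hI1, hI3⟩

end Clauses

/-! ## §3 `transfFam` does not see the repair -/

section Transf

variable {W : Type*}

/-- **`bzExtendG S g` reads `g` on `RegG S` ONLY** (`extendFrom A g` depends on `g|A`). [cite: Bouaziz1994IntegralesOrbitales, §3.1 p. 579] -/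
theorem bzExtendG_congr (S : Finset W) {g g' : (W → Fin 3 → ℝ) → ℂ} (h : EqOn g g' (RegG S)) : bzExtendG S g = bzExtendG S g' := by
  funext c
  by_cases hc : c ∈ RegG S
  · rw [bzExtendG_of_mem_regG S g hc, bzExtendG_of_mem_regG S g' hc, h hc]
  · by_cases hci : c ∈ InRegS S
    · rw [bzExtendG_of_mem_inRegS_of_not_mem_regG S g hci hc, bzExtendG_of_mem_inRegS_of_not_mem_regG S g' hci hc]
      unfold extendFrom Filter.limUnder
      rw [Filter.map_congr (eventually_nhdsWithin_of_forall fun a ha => h ha)]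
    · rw [bzExtendG_of_not_mem_inRegS S g hci, bzExtendG_of_not_mem_inRegS S g' hci]

end Transf

section TransfGen

variable (L : Type) [Field L] [NumberField L] [IsCMField L] (α : Fin 3 → L) (μ : HeckeCharacter L)

/-- `transfFam` of two `G′`-families that agree on every `RegG S` coincide. [cite: Rogawski1990, §4.3 (4.3.1) p. 43] [cite: Bouaziz1994IntegralesOrbitales, §3.1 p. 579] -/
theorem transfFam_eq_of_forall_eqOn_regG {F F' : Finset {w : InfinitePlace L // IsComplex w} → ({w : InfinitePlace L // IsComplex w} → Fin 3 → ℝ) → ℂ}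
    (h : ∀ S, EqOn (F S) (F' S) (RegG S)) : transfFam L α μ F = transfFam L α μ F' := by
  funext S
  rw [transfFam_apply, transfFam_apply]
  exact bzExtendG_congr S (transfFamReg_congr L α μ F F' S (h S))

end TransfGen

section TransfExt

variable (L : Type) [Field L] [NumberField L] [IsCMField L] (α : Fin 3 → L) (μ : HeckeCharacter L)
  [MeasurableSpace ↥(arch (↥(maximalRealSubfield L)) L (IsCMField.complexConj L) 3 (Matrix.diagonal α))] [BorelSpace ↥(arch (↥(maximalRealSubfield L)) L (IsCMField.complexConj L) 3 (Matrix.diagonal α))]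
  (ν' : Measure ↥(arch (↥(maximalRealSubfield L)) L (IsCMField.complexConj L) 3 (Matrix.diagonal α))) [IsFiniteMeasureOnCompacts ν'] [ν'.IsMulRightInvariant]
  (a' : ↥(arch (↥(maximalRealSubfield L)) L (IsCMField.complexConj L) 3 (Matrix.diagonal α)) → ℂ)

/-- **THE CANDIDATE TRANSFER FAMILY DOES NOT SEE THE REPAIR**: `transfFam L α μ (orbFamGExt ν′ a′) = transfFam L α μ (orbFamG ν′ a′)` — the partner sum ★ `transfFamReg S` reads the
`G′`-family at the partner points of `RegG S`, which are `G`-regular (★ `transfFamReg_congr`), where the two families agree literally, and ★ `bzExtendG S` reads `transfFamReg S` on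
`RegG S` only.  Organ O-READ ∕ R0 may keep the raw `orbFamG`. [cite: Rogawski1990, §4.3 (4.3.1) p. 43] [cite: Bouaziz1994IntegralesOrbitales, Rem. 2 p. 594] -/
theorem transfFam_orbFamGExt_eq : transfFam L α μ (orbFamGExt L α ν' a') = transfFam L α μ (orbFamG L α ν' a') :=
  transfFam_eq_of_forall_eqOn_regG L α μ fun S => orbFamGExt_eqOn_regG L α ν' a' S

end TransfExt

/-! ## §4 The assembler for the extended genuine family -/

section Assembly

variable (L : Type) [Field L] [NumberField L] [IsCMField L] (α : Fin 3 → L) (μ : HeckeCharacter L)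
  [MeasurableSpace ↥(arch (↥(maximalRealSubfield L)) L (IsCMField.complexConj L) 3 (Matrix.diagonal α))] [BorelSpace ↥(arch (↥(maximalRealSubfield L)) L (IsCMField.complexConj L) 3 (Matrix.diagonal α))]
  (ν' : Measure ↥(arch (↥(maximalRealSubfield L)) L (IsCMField.complexConj L) 3 (Matrix.diagonal α))) [ν'.IsHaarMeasure] [ν'.IsMulRightInvariant]

/-- **O-L2 FOR THE EXTENDED GENUINE FAMILY ⟺ (SB-TRANSF) ∧ (I₃-TRANSF), HC-FREE** (★ `archBouazizSpaceH_transfFam_iff` with §2's clauses).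
[cite: Bouaziz1994IntegralesOrbitales, §3.2 p. 580; Rem. 2 p. 594] [cite: Rogawski1990, §4.3 (4.3.1) p. 43] [cite: Shelstad1979, Thm. 4.7 (p. 31)] -/
theorem archBouazizSpaceH_transfFam_orbFamGExt_iff (hα : ∀ i, α i ≠ 0) (hreal : ∀ (w : {w : InfinitePlace L // IsComplex w}) (k : Fin 3), (w.1.embedding (α k)).im = 0)
    {a' : ↥(arch (↥(maximalRealSubfield L)) L (IsCMField.complexConj L) 3 (Matrix.diagonal α)) → ℂ} (hc' : HasCompactSupport a')
    (jcH : Finset {w : InfinitePlace L // IsComplex w} → {w : InfinitePlace L // IsComplex w} → ℂ) :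
    ArchBouazizSpaceH jcH (transfFam L α μ (orbFamGExt L α ν' a')) ↔
      ArchBzSmoothBounded (transfFam L α μ (orbFamGExt L α ν' a')) ∧ ArchBzJump jcH (transfFam L α μ (orbFamGExt L α ν' a')) :=
  archBouazizSpaceH_transfFam_iff L α μ (orbFamGExt L α ν' a') (archHcPeriodic_orbFamGExt L α ν' a') (archHcWeyl_orbFamGExt L α ν' hα hreal a')
    (archHcCompactSupport_orbFamGExt L α ν' hc') jcH

/-- The extended genuine family's transform is in `I^st_c(H_∞)` from its two analytic conjuncts. [cite: Bouaziz1994IntegralesOrbitales, §3.2 p. 580; Rem. 2 p. 594] -/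
theorem archBouazizSpaceH_transfFam_orbFamGExt (hα : ∀ i, α i ≠ 0) (hreal : ∀ (w : {w : InfinitePlace L // IsComplex w}) (k : Fin 3), (w.1.embedding (α k)).im = 0)
    {a' : ↥(arch (↥(maximalRealSubfield L)) L (IsCMField.complexConj L) 3 (Matrix.diagonal α)) → ℂ} (hc' : HasCompactSupport a')
    {jcH : Finset {w : InfinitePlace L // IsComplex w} → {w : InfinitePlace L // IsComplex w} → ℂ}
    (hSB : ArchBzSmoothBounded (transfFam L α μ (orbFamGExt L α ν' a'))) (hJ : ArchBzJump jcH (transfFam L α μ (orbFamGExt L α ν' a'))) :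
    ArchBouazizSpaceH jcH (transfFam L α μ (orbFamGExt L α ν' a')) :=
  (archBouazizSpaceH_transfFam_orbFamGExt_iff L α μ ν' hα hreal hc' jcH).2 ⟨hSB, hJ⟩

end Assembly

end Literature.NumberTheory.Rogawski1990

end
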